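import Mathlib.LinearAlgebra.FreeModule.ModN
import Mathlib.RingTheory.PrincipalIdealDomain
import Mathlib.Data.Nat.Prime.Int
import Literature.NumberTheory.EllipticCurves.BSDRankZeroFamily
import Literature.NumberTheory.EllipticCurves.MordellWeilProofs
import HarnessLib

/-!
# The average rank of elliptic curves over `ℚ` is less than `0.885`: Bhargava–Shankar's proof,
# reduced to its three inputs

Topic `Literature/NumberTheory/EllipticCurves`, family `bsd` (**bsd.S26**). This file serves the
named fact `Literature.NumberTheory.EllipticCurves.averageRankLE_of_five_selmer` of `BSDWave0.lean`
(`AverageRankLE 0.885`):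

> M. Bhargava, A. Shankar, *The average size of the 5-Selmer group of elliptic curves is 6, and the
> average rank is less than 1*, arXiv:1312.7859 (2013), **Theorem 3**: "When elliptic curves over
> `ℚ` are ordered by height, their average rank is `< .885`."

The printed proof (§6 of the source, with the last two paragraphs of §1) is a one-page deduction
from three deep inputs: Thm 31 (the `5`-Selmer average in large families: §§2–4, the whole
parametrisation, geometry-of-numbers and sieve argument), Thm 6 (the root-number family of §5) and
Thm 39 (Dokchitser–Dokchitser). None of the three is within reach of the tree; the third is
already the tree's named fact `even_selmerRank_sub_torsionRank_iff`, and the first two are **not**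
vendored as new named facts here (fact-decomposition discipline, D-0026): they are the explicit
hypotheses `h31`, `h6` of the final theorem, transcribed from the printed statements (theorem
numbers of arXiv:1312.7859v1 = the held text) in the vocabulary of large congruence families of
`BSDRankZeroDensity.lean` (where the same programme is carried out for Theorem 4 of the
ternary-cubic-forms paper). Everything downstream of the three inputs is **proved**, ending in
`Literature.NumberTheory.EllipticCurves.averageRankLE_of_five_selmer_of_inputs`; the discharge
`averageRankLE_of_five_selmer_holds` is then the one-liner
`averageRankLE_of_five_selmer_of_inputs thm31 thm6 even_selmerRank_sub_torsionRank_iff_holds` once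
the three inputs are theorems of the tree.

## The printed proof (source §6, pp. 20–21, and §1, pp. 3–4)

* **Thm 31** (§4): for a large family `F`, the average size of the `5`-Selmer group `S₅(E)` over
  `E ∈ F` ordered by height is `6` (Thm 1: all curves; Thm 2: finitely many congruence conditions).
* **Thm 6 with §5** (Props 35, 37, display (35)): there is a finite union `F = F⁺ ∪ F⁻` of large
  families, defined by congruence conditions on `A, B`, of density `μ(F) ≥ .5501`
  (`= .2 × .40914 + .8 × .58534`, §5 last paragraph), such that `E ∈ F ⇒ E₋₁ ∈ F` and
  `d(E) = r(E) r(E₋₁) = -1`; "since the height of `E` is equal to the height of `E₋₁`, it follows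
  that exactly `50%` of elliptic curves in `F` have root number `1`".
* **Thm 39** (Dokchitser–Dokchitser): `s_p(E) - t_p(E)` is even iff the root number of `E` is `+1`
  (`s_p`, `t_p` the ranks of `S_p(E)` and `E(ℚ)[p]`).
* **Prop 38(a)**: `20r - 15 ≤ 5^r`, so Thm 31 bounds the (limsup of the) average `5`-Selmer rank
  of any large family by `21/20 = 1.05`.
* **Prop 40(a)**: in a large family with equidistributed root number, `12n + 1 ≤ 5^n` (`n` even) and
  `60n - 55 ≤ 5^n` (`n` odd) give `6 r̄₅^even + 30 r̄₅^odd ≤ 33`, whence an average `5`-Selmer rank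
  `≤ .75`.
* **Thm 3**: "noting that the `5`-Selmer rank of an elliptic curve `E` is an upper bound for its
  rank", `.5501 × .75 + .4499 × 1.05 = .88497 < .885`.

## What is proved here, and how the bookkeeping is arranged

* `WeierstrassCurve.pow_mordellWeilRank_mul_card_torsionBy_le_card_selmerGroup`: for an elliptic
  curve over a number field and `n ≥ 1`, **`n ^ rank E(K) · #E(K)[n] ≤ #Sel^(n)(E/K)`**, i.e.
  `#(E(K)/nE(K)) = n^r · #E(K)[n]` injected by the Kummer map (Silverman, *AEC*, VIII.§2 and X.4.2;
  the tree's proved `module_finite_point_holds`, `exists_kummerMap_holds`, `finite_selmerGroup_holds`,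
  `finite_torsion_holds`). Consequently `rank E ≤ s₅(E) - t₅(E)`, the very quantity whose parity
  Thm 39 controls, so the source's tacit "`t₅(E) = 0` for `100%` of curves" is not needed.
* `twenty_mul_le_five_pow_add`, `twelve_mul_succ_le_five_pow`: the numerical inequalities of
  Props 38 and 40; `exists_rank_le_of_parity`, `twenty_mul_rank_le`, `twelve_mul_rank_le`: for an
  elliptic curve `E/ℚ`, `rank ≤ m := s₅ - t₅` with `5^m ≤ #S₅` and `m` even iff `w(E) = +1`, hence
  `20·rank ≤ #S₅ + 15`, and `12·rank ≤ #S₅ + 3 - 4·w(E)` (this packages the even/odd inequalities of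
  Prop 40: `12n + 1 ≤ 5^n` for `n` even, `12n - 7 ≤ 60n - 55 ≤ 5^n` for `n` odd).
* `CongruenceFamily.isLarge_allCurves`: the family of all curves (the congruence family with no
  condition, `CongruenceFamily.mk (fun _ ↦ 0) (fun _ ↦ Set.univ) True True`) is large (source §4,
  examples after the definition; here an explicit Chinese-remainder construction, with the Bézout
  lemma `exists_modEq_and_modEq` of `BSDRankZeroFamily.lean`), so that Thm 31 also bounds the
  average over all curves (Thm 1).
* `sum_rootNumber_eq_zero`: on a family stable under `E ↦ E₋₁` with `w(E₋₁) = -w(E)` the root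
  numbers of the members of height `< X` sum to `0` ("exactly `50%`").
* `sum_mordellWeilRank_le`: the finite-height bookkeeping. Writing `S_U`, `S` for the sums of `#S₅`
  over the members of `U`, resp. over all curves, of height `< X`, and `N_U`, `N` for their numbers,
  `∑ rank ≤ S_U/30 + S/20 + 3N/4 - N_U/2` (sum of `12·rank ≤ #S₅ + 3 - 4w` over `U` and of
  `20·rank ≤ #S₅ + 15` over the complement; this is the source's `.75 μ(F) + 1.05 (1 - μ(F))` before
  taking averages, with the complement handled through `S - S_U` rather than as a family).
* `averageRankLE_of_five_selmer_of_inputs`: with `S_U ≤ 6.0001 N_U`, `S ≤ 6.0001 N` (Thm 31 with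
  `ε = 10⁻⁴`) and `N_U ≥ .55009 N` (density `≥ .5501 - 10⁻⁵`), the bound is `≤ .88499 N ≤ .885 N`.
* `averageRankLE_onePointZeroFive_of_heightAverageLE_card_selmerFive` (last section): the
  source's first step (§1 p. 4 and Prop 38(a)), "Theorem 1 immediately yields an upper bound of
  `1.05` on the average rank": `AverageRankLE 1.05` granted **only Theorem 1** in `limsup` form
  (`HeightAverageLE (#Sel^(5)) 6`, the shape of the tree's `heightAverageLE_card_selmerTwo`) — no
  root numbers, no parity theorem, no large families; via the unconditional pointwise bound
  `twenty_mul_mordellWeilRank_le` (`20·rank ≤ #S₅ + 15`) and the affine averaging lemma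
  `HeightAverageLE.of_le_const_mul_add`.

## Remarks on faithfulness

* Thm 31 asserts *equality* (`= 6`) of the limit for every large family in the source's sense
  (closed `Σ_p ⊆ ℤ_p²` with measure-zero boundary); hypothesis `h31` keeps only `limsup ≤ 6`, for the
  clopen congruence families `CongruenceFamily` of `BSDRankZeroDensity.lean` (conditions on the
  residue of `(A, B)` modulo a fixed power of each prime, and a sign condition at infinity), whose
  `IsLarge` transcribes "`Inv_p(F) ⊇ {(I, J) : p² ∤ Δ(I, J)}` for all but finitely many `p`"
  literally. It is therefore weaker than the printed theorem. The source's height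
  `H' = max(|I|³, J²/4) = (27/4)·H` induces the same ordering as the naive height `H`.
* Thm 6 is transcribed (hypothesis `h6`) as an existence statement in the same vocabulary: finitely
  many pairwise disjoint large congruence families (the pieces of `F⁺`, `F⁻` of display (35):
  conditions modulo powers of `2`, `3` from Prop 35, modulo `p⁵` at the primes `p ≡ 3 (mod 4)` from
  Prop 37 with at most two exceptional primes `< 10000`, and a sign condition) whose union has
  lower density `≥ .5501`,
  is stable under `(A, B) ↦ (A, -B)` (`E₋₁ = E_{A,-B}`), and on which this involution reverses the
  root number (`d(E) = -1`). The printed "density greater than `55.01%`" is kept as `≥ .5501` in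
  `liminf` form (`HeightDensityGE`).
* Thm 39 is the tree's `even_selmerRank_sub_torsionRank_iff` (`BSDRankZeroDensity.lean`, stated for
  every prime `p`; Dokchitser–Dokchitser, Ann. of Math. 172 (2010), Thm 1.4).
* The conclusion proved is `limsup ≤ 0.885` (indeed eventually `≤ 0.885`), as stated by
  `averageRankLE_of_five_selmer`; the source's `.88497` is not recorded.

## References

* [BhargavaShankar5Selmer2013] M. Bhargava, A. Shankar, *The average size of the 5-Selmer group of
  elliptic curves is 6, and the average rank is less than 1*, arXiv:1312.7859: Thms 1–3, 6, 31, 39,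
  Props 35, 37, 38, 40, §6.
* [BhargavaShankarTernary2015] M. Bhargava, A. Shankar, Ann. of Math. 181 (2015) 587–621, §3
  (large families).
* [BhargavaSkinnerZhang2014] M. Bhargava, C. Skinner, W. Zhang, arXiv:1407.1826, §2.3, Thm 13.
* [DokchitserDokchitserAnnals2010] T. Dokchitser, V. Dokchitser, Ann. of Math. 172 (2010)
  567–596, Thm 1.4.
* [SilvermanAEC2009] J. H. Silverman, *The Arithmetic of Elliptic Curves*, 2nd ed., VIII.§2,
  Thm VIII.6.7, Thm X.4.2.
-/

noncomputable section

open scoped Classical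
open scoped AddSubgroup
open Filter Topology WeierstrassCurve

/-! ### The descent inequality with the torsion factor -/

namespace WeierstrassCurve

universe u

variable {K : Type u} [Field K] [NumberField K] (W : WeierstrassCurve K) [W.IsElliptic]

/-- **Descent inequality with torsion** (Silverman, *AEC*, VIII.§2 and Thm X.4.2(a) with
Thm VIII.6.7; the exact sequence `0 → E(ℚ) /5E(ℚ) → S₅(E) → Ш_E[5] → 0` displayed in §1 of
Bhargava–Shankar, arXiv:1312.7859, p. 4). For an elliptic curve `E` over a number field `K` and
`n ≥ 1`, `n ^ rank E(K) · #E(K)[n] ≤ #Sel^(n)(E/K)`.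
Proof: the Kummer map `κ` (`exists_kummerMap_holds`) has kernel `nE(K)` and image inside
`Sel^(n)(E/K)` (finite, `finite_selmerGroup_holds`), so `#(E(K)/nE(K)) ≤ #Sel^(n)`. With
`T = E(K)_tors` (finite, `finite_torsion_holds`) and `F = E(K)/T` free of rank `r` (Mordell–Weil,
`module_finite_point_holds`), the surjection `E(K)/nE(K) ↠ F/nF` (`#(F/nF) = n^r`, Mathlib
`ModN.natCard_eq`) has kernel containing the image of `T`, which is `T/(T ∩ nE(K)) = T/nT` because
`F` is torsion-free; and `#(T/nT) = #T[n] = #E(K)[n]` for the finite group `T`.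
[cite: SilvermanAEC2009, Thm X.4.2] -/
theorem pow_mordellWeilRank_mul_card_torsionBy_le_card_selmerGroup {n : ℕ} (hn : n ≠ 0) :
    n ^ W.mordellWeilRank * Nat.card (W.toAffine.Point[(n : ℤ)]) ≤
      Nat.card (W.selmerGroup n) := by
  haveI : NeZero n := ⟨hn⟩
  have hn' : (n : ℤ) ≠ 0 := Int.natCast_ne_zero.mpr hn
  haveI hSel : Finite (W.selmerGroup n) := W.finite_selmerGroup_holds hn'
  obtain ⟨κ, hker, hrange⟩ := W.exists_kummerMap_holds hn'
  -- Mordell–Weil: `E(K)` is finitely generated, `F = E(K)/tors` is free of rank `rank E(K)`,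
  -- `T = E(K)_tors` is finite
  haveI : Module.Finite ℤ W.toAffine.Point := W.module_finite_point_holds
  haveI : Module.Free ℤ (mordellWeilModTorsion W) :=
    module_free_mordellWeilModTorsion W W.module_finite_point_holds
  haveI : Module.Finite ℤ (mordellWeilModTorsion W) :=
    Module.Finite.of_surjective
      ((QuotientAddGroup.mk' (AddCommGroup.torsion W.toAffine.Point)).toIntLinearMap)
      (QuotientAddGroup.mk'_surjective (AddCommGroup.torsion W.toAffine.Point))
  have hrank : Module.finrank ℤ (mordellWeilModTorsion W) = W.mordellWeilRank :=
    finrank_mordellWeilModTorsion_eq_holds W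
  set T : AddSubgroup W.toAffine.Point := AddCommGroup.torsion W.toAffine.Point with hTdef
  haveI hTfin : Finite T := W.finite_torsion_holds
  -- `φ : E(K) ↠ F ↠ F/nF` kills `nE(K) = ker κ`
  set φ : W.toAffine.Point →+ ModN (mordellWeilModTorsion W) n :=
    (ModN.mkQ (G := mordellWeilModTorsion W) n).comp (QuotientAddGroup.mk' T) with hφdef
  have hφ : Function.Surjective φ :=
    (Submodule.mkQ_surjective _).comp (QuotientAddGroup.mk'_surjective _)
  have hkill : ∀ x : ModN (mordellWeilModTorsion W) n, (n : ℤ) • x = 0 := fun x ↦ by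
    rw [natCast_zsmul, ← Nat.cast_smul_eq_nsmul (ZMod n), ZMod.natCast_self, zero_smul]
  have hle : κ.ker ≤ φ.ker := by
    rw [hker]
    rintro _ ⟨m, rfl⟩
    rw [AddMonoidHom.mem_ker, zsmulAddGroupHom_apply, map_zsmul, hkill]
  -- `Q = E(K)/nE(K) ≅ im κ ⊆ Sel^(n)`
  have hsub : κ.range ≤ W.selmerGroup n := hrange ▸ inf_le_left
  haveI : Finite κ.range := Finite.of_injective _ (AddSubgroup.inclusion_injective hsub)
  haveI hQfin : Finite (W.toAffine.Point ⧸ κ.ker) :=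
    Finite.of_equiv _ (QuotientAddGroup.quotientKerEquivRange κ).toEquiv.symm
  have hQ1 : Nat.card (W.toAffine.Point ⧸ κ.ker) = Nat.card κ.range :=
    Nat.card_congr (QuotientAddGroup.quotientKerEquivRange κ).toEquiv
  have hQ2 : Nat.card κ.range ≤ Nat.card (W.selmerGroup n) :=
    Nat.card_le_card_of_injective _ (AddSubgroup.inclusion_injective hsub)
  -- `ψ : Q ↠ F/nF`, `#Q = #ker ψ · n ^ r`
  set ψ : W.toAffine.Point ⧸ κ.ker →+ ModN (mordellWeilModTorsion W) n :=
    QuotientAddGroup.lift κ.ker φ hle with hψdef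
  have hψ : Function.Surjective ψ := fun y ↦ by
    obtain ⟨m, rfl⟩ := hφ y
    exact ⟨m, QuotientAddGroup.lift_mk κ.ker hle m⟩
  have hQ3 : Nat.card (W.toAffine.Point ⧸ κ.ker) = Nat.card ψ.ker * n ^ W.mordellWeilRank := by
    rw [AddSubgroup.card_eq_card_quotient_mul_card_addSubgroup ψ.ker,
      Nat.card_congr (QuotientAddGroup.quotientKerEquivRange ψ).toEquiv,
      AddMonoidHom.range_eq_top.mpr hψ, AddSubgroup.card_top, ModN.natCard_eq, hrank, mul_comm]
  -- `θ : T → Q` lands in `ker ψ`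
  set θ : T →+ W.toAffine.Point ⧸ κ.ker := (QuotientAddGroup.mk' κ.ker).comp T.subtype
    with hθdef
  have hθapply : ∀ t : T, θ t = ((t : W.toAffine.Point) : W.toAffine.Point ⧸ κ.ker) :=
    fun t ↦ rfl
  have hθψ : θ.range ≤ ψ.ker := by
    rintro _ ⟨t, rfl⟩
    rw [AddMonoidHom.mem_ker, hθapply, hψdef, QuotientAddGroup.lift_mk, hφdef,
      AddMonoidHom.coe_comp, Function.comp_apply, QuotientAddGroup.mk'_apply,
      (QuotientAddGroup.eq_zero_iff _).mpr t.2, map_zero]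
  -- `μ = [n] : T → T`; `ker θ = T ∩ nE(K) = nT = im μ` since `E(K)/T` is torsion-free
  set μ : T →+ T := zsmulAddGroupHom (n : ℤ) with hμdef
  have hθker : θ.ker = μ.range := by
    ext t
    rw [AddMonoidHom.mem_ker, hθapply, QuotientAddGroup.eq_zero_iff, hker]
    constructor
    · rintro ⟨m, hm⟩
      rw [zsmulAddGroupHom_apply] at hm
      have hmT : m ∈ T := by
        rw [hTdef, AddCommGroup.mem_torsion]
        have ht : IsOfFinAddOrder (t : W.toAffine.Point) := by
          rw [← AddCommGroup.mem_torsion, ← hTdef]; exact t.2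
        rw [← hm, natCast_zsmul] at ht
        exact ht.of_nsmul hn
      refine ⟨⟨m, hmT⟩, Subtype.ext ?_⟩
      rw [hμdef, zsmulAddGroupHom_apply, AddSubgroupClass.coe_zsmul]
      exact hm
    · rintro ⟨t', rfl⟩
      refine ⟨(t' : W.toAffine.Point), ?_⟩
      rw [zsmulAddGroupHom_apply, hμdef, zsmulAddGroupHom_apply, AddSubgroupClass.coe_zsmul]
  -- `#(T/nT) = #T[n]` for the finite group `T`
  have hμpos : 0 < Nat.card μ.range := Nat.card_pos
  have hT1 := AddSubgroup.card_eq_card_quotient_mul_card_addSubgroup μ.range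
  have hT2 := AddSubgroup.card_eq_card_quotient_mul_card_addSubgroup μ.ker
  have hT3 : Nat.card (T ⧸ μ.ker) = Nat.card μ.range :=
    Nat.card_congr (QuotientAddGroup.quotientKerEquivRange μ).toEquiv
  have hT4 : Nat.card (T ⧸ μ.range) = Nat.card μ.ker := by
    rw [hT3] at hT2
    rw [mul_comm] at hT1
    exact Nat.eq_of_mul_eq_mul_left hμpos (hT1.symm.trans hT2)
  -- `E(K)[n] ↪ ker μ = T[n]`
  have hT5 : Nat.card (W.toAffine.Point[(n : ℤ)]) ≤ Nat.card μ.ker := by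
    have hmemT : ∀ m : W.toAffine.Point, m ∈ W.toAffine.Point[(n : ℤ)] → m ∈ T := fun m hm ↦ by
      rw [hTdef, AddCommGroup.mem_torsion, isOfFinAddOrder_iff_zsmul_eq_zero]
      exact ⟨n, hn', (Submodule.mem_torsionBy_iff _ _).mp hm⟩
    have hmemK : ∀ m : W.toAffine.Point[(n : ℤ)], (⟨m.1, hmemT m.1 m.2⟩ : T) ∈ μ.ker := fun m ↦ by
      rw [AddMonoidHom.mem_ker, hμdef, zsmulAddGroupHom_apply]
      exact Subtype.ext (by
        rw [AddSubgroupClass.coe_zsmul, ZeroMemClass.coe_zero]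
        exact (Submodule.mem_torsionBy_iff _ _).mp m.2)
    refine Nat.card_le_card_of_injective (fun m ↦ (⟨⟨m.1, hmemT m.1 m.2⟩, hmemK m⟩ : μ.ker))
      fun m₁ m₂ h ↦ Subtype.ext ?_
    have := congrArg (fun x : μ.ker ↦ ((x : T) : W.toAffine.Point)) h
    exact this
  -- assemble: `n^r · #E(K)[n] ≤ n^r · #ker ψ = #Q ≤ #Sel^(n)`
  have hT6 : Nat.card (W.toAffine.Point[(n : ℤ)]) ≤ Nat.card ψ.ker :=
    calc Nat.card (W.toAffine.Point[(n : ℤ)]) ≤ Nat.card μ.ker := hT5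
      _ = Nat.card (T ⧸ μ.range) := hT4.symm
      _ = Nat.card (T ⧸ θ.ker) :=
          (Nat.card_congr (QuotientAddGroup.quotientAddEquivOfEq hθker).toEquiv).symm
      _ = Nat.card θ.range := Nat.card_congr (QuotientAddGroup.quotientKerEquivRange θ).toEquiv
      _ ≤ Nat.card ψ.ker := Nat.card_le_card_of_injective _ (AddSubgroup.inclusion_injective hθψ)
  calc n ^ W.mordellWeilRank * Nat.card (W.toAffine.Point[(n : ℤ)])
      ≤ n ^ W.mordellWeilRank * Nat.card ψ.ker := Nat.mul_le_mul_left _ hT6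
    _ = Nat.card (W.toAffine.Point ⧸ κ.ker) := by rw [hQ3, mul_comm]
    _ ≤ Nat.card (W.selmerGroup n) := hQ1.trans_le hQ2

end WeierstrassCurve

namespace Literature.NumberTheory.EllipticCurves

/-! ### The numerical inequalities of Props 38 and 40 -/

/-- `20 r - 15 ≤ 5 ^ r` for every natural number `r` (source, §1 p. 4 and proof of Prop 38), in the
form `20 r ≤ 5 ^ r + 15`. [cite: BhargavaShankar5Selmer2013, Prop 38 (proof)] -/
theorem twenty_mul_le_five_pow_add (r : ℕ) : 20 * r ≤ 5 ^ r + 15 := by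
  induction r with
  | zero => norm_num
  | succ k ih =>
    rcases Nat.eq_zero_or_pos k with rfl | hk
    · norm_num
    · have h5 : 5 ≤ 5 ^ k := by
        calc 5 = 5 ^ 1 := (pow_one 5).symm
          _ ≤ 5 ^ k := Nat.pow_le_pow_right (by norm_num) hk
      calc 20 * (k + 1) = 20 * k + 20 := by ring
        _ ≤ 5 ^ k + 15 + 20 := by omega
        _ ≤ 5 ^ (k + 1) + 15 := by rw [pow_succ]; omega

/-- `12 n + 1 ≤ 5 ^ n` for `n ≥ 2` (and for `n = 0`); the source uses it for `n` even
(proof of Prop 40: "`12n + 1 ≤ 5^n` for `n` even"), and for odd `n ≥ 3` it implies the weaker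
consequence `12 n - 7 ≤ 5 ^ n` of the printed `60n - 55 ≤ 5^n`.
[cite: BhargavaShankar5Selmer2013, Prop 40 (proof)] -/
theorem twelve_mul_succ_le_five_pow {n : ℕ} (hn : 2 ≤ n) : 12 * n + 1 ≤ 5 ^ n := by
  induction n, hn using Nat.le_induction with
  | base => norm_num
  | succ k hk ih =>
    have h5 : 25 ≤ 5 ^ k := by
      calc 25 = 5 ^ 2 := by norm_num
        _ ≤ 5 ^ k := Nat.pow_le_pow_right (by norm_num) hk
    calc 12 * (k + 1) + 1 = 12 * k + 1 + 12 := by ring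
      _ ≤ 5 ^ k + 12 := by omega
      _ ≤ 5 ^ (k + 1) := by rw [pow_succ]; omega

/-- The even case of Prop 40: `12 n + 1 ≤ 5 ^ n` for `n` even.
[cite: BhargavaShankar5Selmer2013, Prop 40 (proof)] -/
theorem twelve_mul_add_one_le_five_pow_of_even {n : ℕ} (hn : Even n) : 12 * n + 1 ≤ 5 ^ n := by
  rcases Nat.eq_zero_or_pos n with rfl | hpos
  · norm_num
  · refine twelve_mul_succ_le_five_pow ?_
    obtain ⟨k, rfl⟩ := hn
    omega

/-- The odd case of Prop 40, in the weak form used here: `12 n ≤ 5 ^ n + 7` for `n` odd (the source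
has `60n - 55 ≤ 5^n`; only `12n - 7 ≤ 5^n`, i.e. the line through `(1, 5)` of slope `12`, is needed).
[cite: BhargavaShankar5Selmer2013, Prop 40 (proof)] -/
theorem twelve_mul_le_five_pow_add_of_odd {n : ℕ} (hn : Odd n) : 12 * n ≤ 5 ^ n + 7 := by
  obtain ⟨k, rfl⟩ := hn
  rcases Nat.eq_zero_or_pos k with rfl | hk
  · norm_num
  · have h := twelve_mul_succ_le_five_pow (n := 2 * k + 1) (by omega)
    generalize 5 ^ (2 * k + 1) = N at h ⊢
    omega

/-! ### Per-curve consequences: `rank ≤ s₅ - t₅`, whose parity is the root number -/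

section PerCurve

variable (W : WeierstrassCurve ℚ) [W.IsElliptic] (p : ℕ) [Fact p.Prime]

/-- Over `ℚ` (instance bridge, cf. the module docstring of `BSDRankZeroDensity.lean`: statements
about `E(ℚ)` written over `ℚ` use `instDecidableEqRat`, the general lemmas the classical instance):
`#E(ℚ)[p] = p ^ t` for some `t` (`exists_natCard_torsionBy_eq_pow`, from the Mordell–Weil
theorem). [cite: SilvermanAEC2009, Thm. VIII.6.7] -/
theorem exists_natCard_torsionBy_eq_pow_rat :
    ∃ t : ℕ, Nat.card (W.toAffine.Point[(p : ℤ)]) = p ^ t := by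
  obtain ⟨t, ht⟩ := exists_natCard_torsionBy_eq_pow W p
  exact ⟨t, by convert ht⟩

/-- Over `ℚ` (instance bridge): the descent inequality with torsion,
`p ^ rank E(ℚ) · #E(ℚ)[p] ≤ #Sel^(p)(E/ℚ)`
(`WeierstrassCurve.pow_mordellWeilRank_mul_card_torsionBy_le_card_selmerGroup`).
[cite: SilvermanAEC2009, Thm X.4.2] -/
theorem pow_mordellWeilRank_mul_card_torsionBy_le_rat :
    p ^ W.mordellWeilRank * Nat.card (W.toAffine.Point[(p : ℤ)]) ≤ Nat.card (W.selmerGroup p) := by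
  convert W.pow_mordellWeilRank_mul_card_torsionBy_le_card_selmerGroup (Fact.out : p.Prime).ne_zero

/-- **"The `5`-Selmer rank of an elliptic curve `E` is an upper bound for its rank"** (source §6,
last paragraph) combined with **Thm 39** (Dokchitser–Dokchitser, hypothesis `hDD` in the form
`even_selmerRank_sub_torsionRank_iff`): for an elliptic curve `E/ℚ` and a prime `p` there is a
natural number `m` (namely `m = s_p(E) - t_p(E)`, `#Sel^(p) = p^s`, `#E(ℚ)[p] = p^t`) with
`rank E(ℚ) ≤ m`, `p ^ m ≤ #Sel^(p)(E/ℚ)`, and `m` even iff `w(E) = +1`. The first inequality is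
`p^{r+t} = #(E(ℚ)/pE(ℚ)) ≤ #Sel^(p) = p^s` (`pow_mordellWeilRank_mul_card_torsionBy_le_rat`).
[cite: BhargavaShankar5Selmer2013, Thm 39 and §6 (last paragraph)] -/
theorem exists_rank_le_of_parity (hDD : even_selmerRank_sub_torsionRank_iff) :
    ∃ m : ℕ, W.mordellWeilRank ≤ m ∧ p ^ m ≤ Nat.card (W.selmerGroup p) ∧
      (Even m ↔ W.rootNumber = 1) := by
  have hp : p.Prime := Fact.out
  obtain ⟨s, hs⟩ := exists_natCard_selmerGroup_eq_pow W p
  obtain ⟨t, ht⟩ := exists_natCard_torsionBy_eq_pow_rat W p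
  have hpar := hDD W p s t hs ht
  have hineq := pow_mordellWeilRank_mul_card_torsionBy_le_rat W p
  rw [ht, hs, ← pow_add] at hineq
  have hle : W.mordellWeilRank + t ≤ s := (Nat.pow_le_pow_iff_right hp.two_le).mp hineq
  refine ⟨s - t, by omega, ?_, ?_⟩
  · rw [hs]
    exact Nat.pow_le_pow_right hp.pos (Nat.sub_le s t)
  · rw [← hpar, show ((s : ℤ) - t) = ((s - t : ℕ) : ℤ) by omega, Int.even_coe_nat]

/-- **Prop 38 pointwise** ("`20r - 15 ≤ 5^r`" and "the `5`-Selmer rank is an upper bound for the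
rank", source §6): for every elliptic curve `E/ℚ`, `20 · rank E(ℚ) ≤ #Sel^(5)(E/ℚ) + 15`
(granted Thm 39, used only to produce the integer `m = s₅ - t₅ ≥ rank`; in fact `5^rank ≤ #Sel^(5)`
alone would do here). [cite: BhargavaShankar5Selmer2013, Prop 38(a) (proof)] -/
theorem twenty_mul_rank_le (hDD : even_selmerRank_sub_torsionRank_iff) :
    20 * (W.mordellWeilRank : ℝ) ≤ (Nat.card (W.selmerGroup 5) : ℝ) + 15 := by
  haveI : Fact (Nat.Prime 5) := ⟨by norm_num⟩
  obtain ⟨m, hrm, hpow, -⟩ := exists_rank_le_of_parity W 5 hDD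
  have h1 := twenty_mul_le_five_pow_add m
  have h2 : (20 * m : ℝ) ≤ (Nat.card (W.selmerGroup 5) : ℝ) + 15 := by
    exact_mod_cast h1.trans (Nat.add_le_add_right hpow 15)
  have h3 : (W.mordellWeilRank : ℝ) ≤ m := by exact_mod_cast hrm
  linarith

/-- **Prop 40 pointwise** (source §6, proof of Prop 40: "`12n + 1 ≤ 5^n` for `n` even and
`60n - 55 ≤ 5^n` for `n` odd", with Thm 39: `n = s₅ - t₅` is even iff `w(E) = +1`): for every
elliptic curve `E/ℚ`, `12 · rank E(ℚ) ≤ #Sel^(5)(E/ℚ) + 3 - 4 w(E)`, i.e. `≤ #Sel^(5) - 1` if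
`w(E) = +1` and `≤ #Sel^(5) + 7` if `w(E) = -1`.
[cite: BhargavaShankar5Selmer2013, Prop 40(a) (proof) and Thm 39] -/
theorem twelve_mul_rank_le (hDD : even_selmerRank_sub_torsionRank_iff) :
    12 * (W.mordellWeilRank : ℝ) ≤
      (Nat.card (W.selmerGroup 5) : ℝ) + 3 - 4 * (W.rootNumber : ℝ) := by
  haveI : Fact (Nat.Prime 5) := ⟨by norm_num⟩
  obtain ⟨m, hrm, hpow, hpar⟩ := exists_rank_le_of_parity W 5 hDD
  have h3 : (W.mordellWeilRank : ℝ) ≤ m := by exact_mod_cast hrm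
  have hpow' : ((5 : ℕ) ^ m : ℝ) ≤ (Nat.card (W.selmerGroup 5) : ℝ) := by exact_mod_cast hpow
  push_cast at hpow'
  rcases W.rootNumber_eq_one_or with hw | hw
  · have hev : Even m := hpar.mpr hw
    have h1 : (12 * m + 1 : ℝ) ≤ (5 : ℝ) ^ m := by
      exact_mod_cast twelve_mul_add_one_le_five_pow_of_even hev
    rw [hw]
    push_cast
    linarith
  · have hodd : Odd m := by
      rcases Nat.even_or_odd m with h | h
      · exact absurd (hpar.mp h) (by rw [hw]; norm_num)
      · exact h
    have h1 : (12 * m : ℝ) ≤ (5 : ℝ) ^ m + 7 := by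
      exact_mod_cast twelve_mul_le_five_pow_add_of_odd hodd
    rw [hw]
    push_cast
    linarith

end PerCurve

/-! ### The family of all curves is large -/

/-- A pair `(A, B)` with `B` odd and `gcd(A, B) = 1` belongs to the height family: `4A³ + 27B²` is
odd, hence non-zero, and no prime divides both `A` and `B` (elementary). [folklore] -/
theorem isInHeightFamily_of_odd_of_coprime {A B : ℤ} (hB : Odd B)
    (hcop : ∀ q : ℕ, q.Prime → (q : ℤ) ∣ A → (q : ℤ) ∣ B → False) : IsInHeightFamily (A, B) := by
  show 4 * A ^ 3 + 27 * B ^ 2 ≠ 0 ∧ ∀ p : ℕ, p.Prime → ¬((p : ℤ) ^ 4 ∣ A ∧ (p : ℤ) ^ 6 ∣ B)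
  refine ⟨fun h ↦ ?_, fun q hq hdvd ↦ hcop q hq ?_ ?_⟩
  · have hodd : Odd (4 * A ^ 3 + 27 * B ^ 2) := by
      have h1 : Even (4 * A ^ 3) := ⟨2 * A ^ 3, by ring⟩
      have h2 : Odd (27 * B ^ 2) := Odd.mul (Int.odd_iff.mpr (by norm_num)) hB.pow
      exact h1.add_odd h2
    rw [h] at hodd
    exact (Int.not_even_iff_odd.mpr hodd) (⟨0, by norm_num⟩ : Even (0 : ℤ))
  · exact (dvd_pow_self (q : ℤ) four_ne_zero).trans hdvd.1
  · exact (dvd_pow_self (q : ℤ) (by norm_num : (6 : ℕ) ≠ 0)).trans hdvd.2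

/-- If `x ≡ 1 (mod d)` then no prime divides both `d` and `x` (elementary). [folklore] -/
theorem not_dvd_of_modEq_one {d x : ℤ} (h : x ≡ 1 [ZMOD d]) (q : ℕ) (hq : q.Prime)
    (hqd : (q : ℤ) ∣ d) (hqx : (q : ℤ) ∣ x) : False := by
  have h1 : d ∣ 1 - x := Int.modEq_iff_dvd.mp h
  have h2 : (q : ℤ) ∣ (1 - x) + x := dvd_add (hqd.trans h1) hqx
  rw [sub_add_cancel] at h2
  exact (Nat.prime_iff_prime_int.mp hq).not_dvd_one h2

namespace CongruenceFamily

/-! The family of **all** elliptic curves `E_{A,B}/ℚ` as a congruence family is the structure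
`CongruenceFamily.mk (fun _ ↦ 0) (fun _ ↦ Set.univ) True True` (level `p ^ 0` and all residues
allowed at every prime, both signs of the discriminant allowed); it is written out literally below
(this file adds theorems only). The source lists it as the first example of a large family
(Bhargava–Shankar, arXiv:1312.7859, §4; Bhargava–Shankar, Ann. of Math. 181 (2015) 587–621, §3). -/

/-- Membership in the family of all curves (no congruence condition) is membership in the height
family. [folklore] -/
theorem mem_allCurves_iff (AB : ℤ × ℤ) :
    (CongruenceFamily.mk (fun _ ↦ 0) (fun _ ↦ Set.univ) True True).Mem AB ↔ IsInHeightFamily AB :=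
  ⟨fun h ↦ h.1, fun h ↦ ⟨h, fun _ _ ↦ Set.mem_univ _, fun _ ↦ trivial, fun _ ↦ trivial⟩⟩

/-- **The family of all curves is large** (source §4, first example after the definition): for every
prime `p ≥ 3`, every `(a, b) ∈ ℤ²` with `p² ∤ 4a³ + 27b²` and every `k` there is a member `(A, B)`
of the height family with `(A, B) ≡ (a, b) (mod p^k)`. Construction (Chinese remainder theorem):
if `p ∤ a` take `A = a` and `B ≡ b (mod p^{k+1})`, `B ≡ 1 (mod 2a)`; if `p ∣ a` (so `p ∤ b`) take
`B ≡ b (mod p^{k+1})` odd and `A ≡ a (mod p^{k+1})`, `A ≡ 1 (mod B)`; in both cases `B` is odd and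
`gcd(A, B) = 1`, so `(A, B)` is in the family (`isInHeightFamily_of_odd_of_coprime`).
[cite: BhargavaShankar5Selmer2013, §4 (large families: "all curves")] -/
theorem isLarge_allCurves :
    (CongruenceFamily.mk (fun _ ↦ 0) (fun _ ↦ Set.univ) True True).IsLarge := by
  refine ⟨3, fun p hp3 hp a b k hΔ ↦ ?_⟩
  have hpZ : Prime (p : ℤ) := Nat.prime_iff_prime_int.mp hp
  have hcop : ∀ c : ℤ, ¬ (p : ℤ) ∣ c → IsCoprime (p : ℤ) c := fun c hc ↦
    hpZ.irreducible.coprime_iff_not_dvd.mpr hc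
  have hp2 : ¬ (p : ℤ) ∣ 2 := fun h ↦ by
    have h' : p ∣ 2 := by exact_mod_cast h
    have := Nat.le_of_dvd two_pos h'
    omega
  have hdvdk : (p : ℤ) ^ k ∣ (p : ℤ) ^ (k + 1) := pow_dvd_pow _ (Nat.le_succ k)
  have hpk : (p : ℤ) ∣ (p : ℤ) ^ (k + 1) := dvd_pow_self _ (Nat.succ_ne_zero k)
  by_cases hpa : (p : ℤ) ∣ a
  · -- then `p ∤ b`
    have hpb : ¬ (p : ℤ) ∣ b := fun hpb ↦ by
      obtain ⟨a', rfl⟩ := hpa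
      obtain ⟨b', rfl⟩ := hpb
      exact hΔ ⟨4 * p * a' ^ 3 + 27 * b' ^ 2, by ring⟩
    obtain ⟨B, hBb, hB1⟩ :=
      exists_modEq_and_modEq (m := (p : ℤ) ^ (k + 1)) (n := 2) (hcop 2 hp2).pow_left b 1
    have hBodd : Odd B := by
      obtain ⟨c, hc⟩ := Int.modEq_iff_dvd.mp hB1
      exact ⟨-c, by linarith⟩
    have hpB : ¬ (p : ℤ) ∣ B := fun hpB ↦ hpb (by
      have h1 : (p : ℤ) ^ (k + 1) ∣ b - B := Int.modEq_iff_dvd.mp hBb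
      have := dvd_add (hpk.trans h1) hpB
      rwa [sub_add_cancel] at this)
    obtain ⟨A, hAa, hA1⟩ :=
      exists_modEq_and_modEq (m := (p : ℤ) ^ (k + 1)) (n := B) (hcop B hpB).pow_left a 1
    refine ⟨(A, B), (mem_allCurves_iff _).mpr (isInHeightFamily_of_odd_of_coprime hBodd
      fun q hq hqA hqB ↦ not_dvd_of_modEq_one hA1 q hq hqB hqA), ?_, ?_⟩
    · exact Int.ModEq.of_dvd hdvdk hAa
    · exact Int.ModEq.of_dvd hdvdk hBb
  · have ha0 : a ≠ 0 := fun h ↦ hpa (h ▸ dvd_zero _)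
    obtain ⟨B, hBb, hB1⟩ :=
      exists_modEq_and_modEq (m := (p : ℤ) ^ (k + 1)) (n := 2 * a)
        ((hcop 2 hp2).mul_right (hcop a hpa)).pow_left b 1
    have hBodd : Odd B := by
      obtain ⟨c, hc⟩ := Int.modEq_iff_dvd.mp hB1
      exact ⟨-(a * c), by linarith⟩
    refine ⟨(a, B), (mem_allCurves_iff _).mpr (isInHeightFamily_of_odd_of_coprime hBodd
      fun q hq hqA hqB ↦ not_dvd_of_modEq_one hB1 q hq (hqA.mul_left 2) hqB), ?_, ?_⟩
    · exact Int.ModEq.refl a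
    · exact Int.ModEq.of_dvd hdvdk hBb

end CongruenceFamily

/-! ### The two deep inputs (Thm 31; Thm 6 with §5)

The tree has no `5`-Selmer average and no root-number family of density `55%`; under the
fact-decomposition discipline (D-0026) this file introduces **no new named fact** for them. They
enter the deduction as the explicit hypotheses `h31` and `h6` of
`averageRankLE_of_five_selmer_of_inputs`, transcribed as follows (in the vocabulary of
`BSDRankZeroDensity.lean`, exactly parallel to its named facts
`heightAverageOn_card_selmerThree_le_four` and `exists_isLarge_rootNumber_twist_family` for the
ternary cubic forms paper).

* `h31` — **Thm 31 of the source.** "Let `F` be a large family of elliptic curves. When elliptic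
  curves `E` in `F` are ordered by height, the average size of the `5`-Selmer group `S₅(E)` is equal
  to `6`." (Thm 1 is the case of all curves, Thm 2 that of finitely many congruence conditions;
  Bhargava–Skinner–Zhang, arXiv:1407.1826, Thm 13 is the same statement for `p = 2, 3, 5`.)
  Transcribed in the weaker `limsup` form and for the (clopen) congruence families
  `CongruenceFamily`: for every large `F` and every `ε > 0`, eventually in `X` the average of
  `#Sel^(5)(E_{A,B}/ℚ)` (`Nat.card` of `WeierstrassCurve.selmerGroup 5`, `Selmer.lean`) over the
  members of `F` of naive height `< X` is at most `6 + ε`. (The source's height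
  `H' = max(|I|³, J²/4) = (27/4)·H`, `(I, J) = (-3A, -27B)`, induces the same ordering, and its real
  parameter `X` specialises to the natural numbers of `heightFamilyBelow`.)
* `h6` — **Thm 6 of the source, with its construction in §5 (Props 35, 37, display (35)).** Thm 6:
  "There exists a family `F` of elliptic curves `E_{A,B}`, having density greater than `55.01%`
  among all elliptic curves when ordered height and defined by congruence conditions on `A` and
  `B`, such that the root number of elliptic curves in `F` is equidistributed." §5: `F = F⁺ ∪ F⁻`
  is a finite union of large families (conditions modulo powers of `2` and `3`, Prop 35; modulo
  powers of the primes `p > 3` with `p ≡ 3 (mod 4)`, Prop 37, with at most two exceptional primes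
  `< 10000`; and a sign condition, display (35)), of density
  `μ(F⁺) + μ(F⁻) ≥ .2 × .40914 + .8 × .58534 = .5501`, such that "every curve `E ∈ F` satisfies
  `E₋₁ ∈ F` and `d(E) = r(E) r(E₋₁) = -1`. Since the height of `E` is equal to the height of `E₋₁`,
  it follows that exactly `50%` of elliptic curves in `F` have root number `1`." Here `E₋₁`, the
  quadratic twist by `-1` of `E = E_{A,B}`, is `E_{A,-B}`, and `r(E)` is the root number
  `WeierstrassCurve.rootNumber` (`RootNumber.lean`). Transcribed as an existence statement:
  finitely many pairwise disjoint large congruence families whose union `U` is stable under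
  `(A, B) ↦ (A, -B)`, on which this involution reverses the root number, and which has lower
  density at least `.5501` (`HeightDensityGE`, i.e. proportion eventually `≥ .5501 - ε` among the
  curves of naive height `< X`).

The third input, Thm 39 (Dokchitser–Dokchitser), is the tree's named fact
`even_selmerRank_sub_torsionRank_iff` (hypothesis `hDD`). -/

/-! ### The deduction of Theorem 3 (source §6) -/

section Reduction

/-- **"Exactly `50%` of elliptic curves in `F` have root number `1`"** (source §5, second page), as a
vanishing sum: if `U` is stable under `E ↦ E₋₁` and `w(E₋₁) = -w(E)` on `U`, then the root numbers
of the members of `U` of naive height `< X` add up to `0` (`card_filter_rootNumber_eq_one_eq`: as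
many have `w = +1` as `w = -1`). [cite: BhargavaShankar5Selmer2013, §5 (construction of F)] -/
theorem sum_rootNumber_eq_zero (U : ℤ × ℤ → Prop) (hU : ∀ AB, U AB → U (negB AB))
    (hflip : ∀ AB, U AB →
      (shortWeierstrass (negB AB)).rootNumber = -(shortWeierstrass AB).rootNumber) (X : ℕ) :
    ∑ AB ∈ (heightFamilyBelow X).filter U, ((shortWeierstrass AB).rootNumber : ℝ) = 0 := by
  have heq := card_filter_rootNumber_eq_one_eq U hU hflip X
  rw [← Finset.sum_filter_add_sum_filter_not ((heightFamilyBelow X).filter U)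
    (fun AB ↦ (shortWeierstrass AB).rootNumber = 1)]
  have h1 : ∑ AB ∈ ((heightFamilyBelow X).filter U).filter
      (fun AB ↦ (shortWeierstrass AB).rootNumber = 1), ((shortWeierstrass AB).rootNumber : ℝ) =
      ((((heightFamilyBelow X).filter U).filter
        (fun AB ↦ (shortWeierstrass AB).rootNumber = 1)).card : ℝ) := by
    rw [Finset.card_eq_sum_ones, Nat.cast_sum]
    refine Finset.sum_congr rfl fun AB hAB ↦ ?_
    rw [(Finset.mem_filter.mp hAB).2]
    norm_num
  have h2 : ∑ AB ∈ ((heightFamilyBelow X).filter U).filter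
      (fun AB ↦ ¬ (shortWeierstrass AB).rootNumber = 1), ((shortWeierstrass AB).rootNumber : ℝ) =
      -((((heightFamilyBelow X).filter U).filter
        (fun AB ↦ ¬ (shortWeierstrass AB).rootNumber = 1)).card : ℝ) := by
    rw [Finset.card_eq_sum_ones, Nat.cast_sum, ← Finset.sum_neg_distrib]
    refine Finset.sum_congr rfl fun AB hAB ↦ ?_
    rw [((shortWeierstrass AB).rootNumber_eq_one_or).resolve_left (Finset.mem_filter.mp hAB).2]
    norm_num
  rw [h1, h2, heq]
  ring

/-- **The bookkeeping of §6 at a finite height `X`** (Props 38(a) and 40(a) combined as in the last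
paragraph of the source, before dividing by the number of curves). Let `U` be stable under
`E ↦ E₋₁` with `w(E₋₁) = -w(E)` on `U`, and grant Thm 39 (`hDD`). Summing `12·rank ≤ #S₅ + 3 - 4w`
(`twelve_mul_rank_le`) over the members of `U` of height `< X` (where `∑ w = 0`,
`sum_rootNumber_eq_zero`) and `20·rank ≤ #S₅ + 15` (`twenty_mul_rank_le`) over the other curves of
height `< X` gives
`∑ rank ≤ (1/30) ∑_U #S₅ + (1/20) ∑_all #S₅ + (3/4) #{all} - (1/2) #{U}`.
[cite: BhargavaShankar5Selmer2013, §6 (proof of Thm 3)] -/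
theorem sum_mordellWeilRank_le (hDD : even_selmerRank_sub_torsionRank_iff) (U : ℤ × ℤ → Prop)
    (hU : ∀ AB, U AB → U (negB AB))
    (hflip : ∀ AB, U AB →
      (shortWeierstrass (negB AB)).rootNumber = -(shortWeierstrass AB).rootNumber) (X : ℕ) :
    ∑ AB ∈ heightFamilyBelow X, ((shortWeierstrass AB).mordellWeilRank : ℝ) ≤
      (1 / 30) * ∑ AB ∈ (heightFamilyBelow X).filter U,
          (Nat.card ((shortWeierstrass AB).selmerGroup 5) : ℝ) +
        (1 / 20) * ∑ AB ∈ heightFamilyBelow X,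
          (Nat.card ((shortWeierstrass AB).selmerGroup 5) : ℝ) +
        (3 / 4) * (heightFamilyBelow X).card - (1 / 2) * ((heightFamilyBelow X).filter U).card := by
  -- members of the height family are elliptic curves
  have hell : ∀ AB ∈ heightFamilyBelow X, (shortWeierstrass AB).IsElliptic :=
    fun AB hAB ↦ isElliptic_shortWeierstrass ((mem_heightFamilyBelow_iff AB X).mp hAB).1
  -- split the rank sum and the Selmer sum according to `U`
  have hsplitR := Finset.sum_filter_add_sum_filter_not (heightFamilyBelow X) U
    (fun AB ↦ ((shortWeierstrass AB).mordellWeilRank : ℝ))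
  have hsplitS := Finset.sum_filter_add_sum_filter_not (heightFamilyBelow X) U
    (fun AB ↦ (Nat.card ((shortWeierstrass AB).selmerGroup 5) : ℝ))
  have hcards := Finset.card_filter_add_card_filter_not (s := heightFamilyBelow X) U
  -- on `U`: `12 r ≤ #Sel + 3 - 4 w`, and `∑ w = 0`
  have hUsum : 12 * ∑ AB ∈ (heightFamilyBelow X).filter U,
      ((shortWeierstrass AB).mordellWeilRank : ℝ) ≤
      ∑ AB ∈ (heightFamilyBelow X).filter U,
          (Nat.card ((shortWeierstrass AB).selmerGroup 5) : ℝ) +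
        3 * ((heightFamilyBelow X).filter U).card := by
    have h := Finset.sum_le_sum (s := (heightFamilyBelow X).filter U)
      (f := fun AB ↦ 12 * ((shortWeierstrass AB).mordellWeilRank : ℝ))
      (g := fun AB ↦ (Nat.card ((shortWeierstrass AB).selmerGroup 5) : ℝ) + 3 -
        4 * ((shortWeierstrass AB).rootNumber : ℝ)) fun AB hAB ↦ by
        haveI := hell AB (Finset.mem_filter.mp hAB).1
        exact twelve_mul_rank_le (shortWeierstrass AB) hDD
    rw [← Finset.mul_sum, Finset.sum_sub_distrib, Finset.sum_add_distrib, ← Finset.mul_sum,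
      sum_rootNumber_eq_zero U hU hflip X, Finset.sum_const, nsmul_eq_mul] at h
    linarith
  -- off `U`: `20 r ≤ #Sel + 15`
  have hCsum : 20 * ∑ AB ∈ (heightFamilyBelow X).filter (fun AB ↦ ¬ U AB),
      ((shortWeierstrass AB).mordellWeilRank : ℝ) ≤
      ∑ AB ∈ (heightFamilyBelow X).filter (fun AB ↦ ¬ U AB),
          (Nat.card ((shortWeierstrass AB).selmerGroup 5) : ℝ) +
        15 * ((heightFamilyBelow X).filter (fun AB ↦ ¬ U AB)).card := by
    have h := Finset.sum_le_sum (s := (heightFamilyBelow X).filter (fun AB ↦ ¬ U AB))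
      (f := fun AB ↦ 20 * ((shortWeierstrass AB).mordellWeilRank : ℝ))
      (g := fun AB ↦ (Nat.card ((shortWeierstrass AB).selmerGroup 5) : ℝ) + 15) fun AB hAB ↦ by
        haveI := hell AB (Finset.mem_filter.mp hAB).1
        exact twenty_mul_rank_le (shortWeierstrass AB) hDD
    rw [← Finset.mul_sum, Finset.sum_add_distrib, Finset.sum_const, nsmul_eq_mul] at h
    linarith
  have hcards' : (((heightFamilyBelow X).filter U).card : ℝ) +
      ((heightFamilyBelow X).filter (fun AB ↦ ¬ U AB)).card = (heightFamilyBelow X).card := by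
    exact_mod_cast hcards
  linarith [hUsum, hCsum, hsplitR, hsplitS, hcards']

/-- **Theorem 3 of the source from its three inputs.** If (`h31`, Thm 31) the average of
`#Sel^(5)` over every large congruence family is eventually `≤ 6 + ε`, (`h6`, Thm 6 with §5) there
is a finite disjoint union `U` of large congruence families of lower density `≥ .5501`, stable
under `E ↦ E₋₁ = E_{A,-B}` with `w(E₋₁) = -w(E)`, and (`hDD`, Thm 39) the parity theorem of
Dokchitser–Dokchitser holds in the `p`-Selmer form `even_selmerRank_sub_torsionRank_iff`, then,
when elliptic curves over `ℚ` are ordered by naive height, the average Mordell–Weil rank is at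
most `0.885` (`limsup` form): the named fact
`Literature.NumberTheory.EllipticCurves.averageRankLE_of_five_selmer`. (See the section comment
above for the transcription of `h31` and `h6` from the printed Thm 31 and Thm 6.) Proof as
printed (§6, last paragraph, with Props 38(a), 40(a)), in the finite-height form
`sum_mordellWeilRank_le`: with `∑_U #S₅ ≤ 6.0001 #U` (`h31` on the pieces of `U`,
`eventually_sum_le_of_heightAverageOn_le`), `∑_all #S₅ ≤ 6.0001 #all` (`h31` on the large family
of all curves, `CongruenceFamily.isLarge_allCurves`) and `#U ≥ .55009 #all` (`h6`), one gets
`∑ rank ≤ .885 · #all`; the source's constant is `.5501 × .75 + .4499 × 1.05 = .88497`. The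
Mordell–Weil theorem, the Kummer sequence and the finiteness of `Sel^(5)` enter through
`pow_mordellWeilRank_mul_card_torsionBy_le_card_selmerGroup`.
[cite: BhargavaShankar5Selmer2013, Thm 3 and §6 (with Thm 31, Thm 6, Thm 39, Props 38, 40)] -/
theorem averageRankLE_of_five_selmer_of_inputs
    (h31 : ∀ F : CongruenceFamily, F.IsLarge → ∀ ε : ℝ, 0 < ε → ∀ᶠ X : ℕ in atTop,
      heightAverageOn F.Mem (fun AB ↦ (Nat.card ((shortWeierstrass AB).selmerGroup 5) : ℝ)) X ≤
        6 + ε)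
    (h6 : ∃ (n : ℕ) (F : Fin n → CongruenceFamily), (∀ i, (F i).IsLarge) ∧
      (∀ i j, i ≠ j → ∀ AB, (F i).Mem AB → ¬ (F j).Mem AB) ∧
      (∀ AB, UnionMem F AB → UnionMem F (AB.1, -AB.2)) ∧
      (∀ AB, UnionMem F AB →
        (shortWeierstrass (AB.1, -AB.2)).rootNumber = -(shortWeierstrass AB).rootNumber) ∧
      HeightDensityGE (UnionMem F) 0.5501)
    (hDD : even_selmerRank_sub_torsionRank_iff) : averageRankLE_of_five_selmer := by
  obtain ⟨n, F, hlarge, hdisj, htwist, hflip, hdens⟩ := h6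
  intro ε hε
  -- Thm 31 on each (disjoint) piece of `U`, summed
  have e1 := eventually_sum_le_of_heightAverageOn_le (fun i ↦ (F i).Mem) hdisj (UnionMem F)
    (fun _ ↦ Iff.rfl) (fun AB ↦ (Nat.card ((shortWeierstrass AB).selmerGroup 5) : ℝ))
    (fun i ↦ h31 (F i) (hlarge i) (1 / 10000) (by norm_num))
  -- Thm 31 on the family of all curves
  have e2 := eventually_sum_le_of_heightAverageOn_le
    (fun _ : Fin 1 ↦ (CongruenceFamily.mk (fun _ ↦ 0) (fun _ ↦ Set.univ) True True).Mem)
    (fun i j hij _ _ ↦ (hij (Subsingleton.elim i j)).elim) IsInHeightFamily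
    (fun AB ↦ ⟨fun h ↦ ⟨0, (CongruenceFamily.mem_allCurves_iff AB).mpr h⟩,
      fun ⟨_, h⟩ ↦ (CongruenceFamily.mem_allCurves_iff AB).mp h⟩)
    (fun AB ↦ (Nat.card ((shortWeierstrass AB).selmerGroup 5) : ℝ))
    (fun _ ↦ h31 _ CongruenceFamily.isLarge_allCurves (1 / 10000) (by norm_num))
  -- the density of `U`
  have e3 := hdens (1 / 100000) (by norm_num)
  filter_upwards [e1, e2, e3] with X hX1 hX2 hX3
  have hfilt : (heightFamilyBelow X).filter IsInHeightFamily = heightFamilyBelow X :=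
    Finset.filter_true_of_mem fun AB hAB ↦ ((mem_heightFamilyBelow_iff AB X).mp hAB).1
  rw [hfilt] at hX2
  rw [heightProportion_eq_card_div] at hX3
  have h885 : (0 : ℝ) ≤ 0.885 := by norm_num
  unfold heightAverage
  beta_reduce
  rcases Nat.eq_zero_or_pos (heightFamilyBelow X).card with h0 | hpos
  · rw [h0, Nat.cast_zero, div_zero]
    linarith
  have hN : (0 : ℝ) < (heightFamilyBelow X).card := by exact_mod_cast hpos
  rw [div_le_iff₀ hN]
  rw [le_div_iff₀ hN] at hX3
  have hmain := sum_mordellWeilRank_le hDD (UnionMem F) (fun AB h ↦ htwist AB h)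
    (fun AB h ↦ hflip AB h) X
  have hSnonneg : 0 ≤ ∑ AB ∈ (heightFamilyBelow X).filter (UnionMem F),
      (Nat.card ((shortWeierstrass AB).selmerGroup 5) : ℝ) :=
    Finset.sum_nonneg fun _ _ ↦ Nat.cast_nonneg _
  have hkey : ∑ AB ∈ heightFamilyBelow X, ((shortWeierstrass AB).mordellWeilRank : ℝ) ≤
      0.885 * (heightFamilyBelow X).card := by
    norm_num at hX1 hX2 hX3 ⊢
    linarith [hmain, hX1, hX2, hX3, hSnonneg]
  have hεN : 0 ≤ ε * ((heightFamilyBelow X).card : ℝ) := mul_nonneg hε.le (Nat.cast_nonneg _)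
  linarith

end Reduction

/-! ### The bound `1.05` from Theorem 1 alone (source §1, p. 4, and Prop 38(a))

"First, we note that Theorem 1 immediately yields an upper bound of `1.05` on the average rank of
elliptic curves. Indeed, … the size of the `5`-Selmer group of `E` is an upper bound for `5^r`.
Since `20r - 15 ≤ 5^r` for any nonnegative integer `r`, we conclude by Theorem 1 that (the limsup
of) the average rank `r̄` of elliptic curves, when ordered by height, must satisfy `20r̄ - 15 ≤ 6`,
whence `r̄ ≤ 21/20`" (source, §1 p. 4; Prop 38(a) is the same computation in any large family).
This step uses neither root numbers nor the parity theorem nor large families, and is recorded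
here granted only Theorem 1 in `limsup` form, `HeightAverageLE (#Sel^(5)(E_{A,B}/ℚ)) 6` (the shape
of the tree's `heightAverageLE_card_selmerTwo` for the `2`-Selmer paper); Theorem 1 itself (§§2–4
of the source) is not vendored here (D-0026). -/

section OnePointZeroFive

/-- **Prop 38(a) pointwise, unconditionally** (source §6, proof of Prop 38, and §1 p. 4:
"`20r - 15 ≤ 5^r`" and "the size of the `5`-Selmer group of `E` is an upper bound for `5^r`"): for
every elliptic curve `E/ℚ`, `20 · rank E(ℚ) ≤ #Sel^(5)(E/ℚ) + 15`. Unlike `twenty_mul_rank_le` this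
takes no parity input: only `5 ^ rank ≤ #Sel^(5)` (`WeierstrassCurve.pow_rank_le_card_selmerGroup`:
Mordell–Weil, the Kummer sequence and the finiteness of the Selmer group, all proved in the tree)
and `twenty_mul_le_five_pow_add`. [cite: BhargavaShankar5Selmer2013, Prop 38(a) (proof) and §1 p. 4] -/
theorem twenty_mul_mordellWeilRank_le (W : WeierstrassCurve ℚ) [W.IsElliptic] :
    20 * (W.mordellWeilRank : ℝ) ≤ (Nat.card (W.selmerGroup 5) : ℝ) + 15 := by
  have h := (twenty_mul_le_five_pow_add W.mordellWeilRank).trans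
    (Nat.add_le_add_right (W.pow_rank_le_card_selmerGroup (by norm_num : (5 : ℕ) ≠ 0)) 15)
  exact_mod_cast h

/-- Affine comparison of `limsup` height averages: if `limsup Avg g ≤ c`, `0 < a`, `0 ≤ b` and
`f ≤ a • g + b` on the height family, then `limsup Avg f ≤ a c + b` (elementary; the sign
condition on `b` is used only through the junk value `Avg = 0` over an empty height box).
[folklore] -/
theorem HeightAverageLE.of_le_const_mul_add {f g : ℤ × ℤ → ℝ} {c a b : ℝ}
    (hg : HeightAverageLE g c) (ha : 0 < a) (hb : 0 ≤ b)
    (hfg : ∀ AB, IsInHeightFamily AB → f AB ≤ a * g AB + b) :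
    HeightAverageLE f (a * c + b) := by
  intro ε hε
  filter_upwards [hg (ε / a) (div_pos hε ha)] with X hX
  have hsplit : heightAverage (fun AB ↦ a * g AB + b) X ≤ a * heightAverage g X + b := by
    unfold heightAverage
    rcases Nat.eq_zero_or_pos (heightFamilyBelow X).card with h0 | hpos
    · rw [Finset.card_eq_zero.mp h0]
      simp [hb]
    · have hN : (0 : ℝ) < (heightFamilyBelow X).card := by exact_mod_cast hpos
      rw [Finset.sum_add_distrib, Finset.sum_const, nsmul_eq_mul, ← Finset.mul_sum, add_div,
        mul_div_assoc, mul_div_cancel_left₀ b hN.ne']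
  calc heightAverage f X ≤ heightAverage (fun AB ↦ a * g AB + b) X := heightAverage_mono hfg X
    _ ≤ a * heightAverage g X + b := hsplit
    _ ≤ a * (c + ε / a) + b := by linarith [mul_le_mul_of_nonneg_left hX ha.le]
    _ = a * c + b + ε := by field_simp; ring

/-- **Source §1 p. 4 (and Prop 38(a) for the family of all curves): the average rank is at most
`1.05`, granted Theorem 1 alone.** If the average of `#Sel^(5)(E_{A,B}/ℚ)` over the curves of naive
height `< X` is eventually `≤ 6 + ε` for every `ε > 0` (Theorem 1 of the source in `limsup` form,
hypothesis `h1`), then `AverageRankLE 1.05`: when elliptic curves over `ℚ` are ordered by naive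
height, `limsup` of the average Mordell–Weil rank is `≤ 21/20`. Proof as printed:
`20 r ≤ #Sel^(5) + 15` pointwise (`twenty_mul_mordellWeilRank_le`), then average
(`HeightAverageLE.of_le_const_mul_add`): `20 r̄ - 15 ≤ 6`. No root numbers, parity theorem or large
families enter (contrast `averageRankLE_of_five_selmer_of_inputs`, which improves `1.05` to `.885`
using Thm 31 on large families, Thm 6 and Thm 39).
[cite: BhargavaShankar5Selmer2013, §1 p. 4 ("whence r̄ ≤ 21/20") and Prop 38(a)] -/
theorem averageRankLE_onePointZeroFive_of_heightAverageLE_card_selmerFive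
    (h1 : HeightAverageLE (fun AB ↦ (Nat.card ((shortWeierstrass AB).selmerGroup 5) : ℝ)) 6) :
    AverageRankLE 1.05 := by
  have h := HeightAverageLE.of_le_const_mul_add
    (f := fun AB ↦ ((shortWeierstrass AB).mordellWeilRank : ℝ)) (a := 1 / 20) (b := 15 / 20) h1
    (by norm_num) (by norm_num) fun AB hAB ↦ by
      haveI := isElliptic_shortWeierstrass hAB
      have h20 := twenty_mul_mordellWeilRank_le (shortWeierstrass AB)
      linarith
  unfold AverageRankLE
  norm_num at h ⊢
  exact h

/-- The same from Theorem 1 as printed, in `Tendsto` form (the average of `#Sel^(5)(E_{A,B}/ℚ)`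
over the curves of height `< X` tends to `6`): `AverageRankLE 1.05`.
[cite: BhargavaShankar5Selmer2013, Thm 1 and §1 p. 4] -/
theorem averageRankLE_onePointZeroFive_of_tendsto_card_selmerFive
    (h1 : Tendsto (fun X ↦ heightAverage
      (fun AB ↦ (Nat.card ((shortWeierstrass AB).selmerGroup 5) : ℝ)) X) atTop (𝓝 6)) :
    AverageRankLE 1.05 :=
  averageRankLE_onePointZeroFive_of_heightAverageLE_card_selmerFive (HeightAverageLE.of_tendsto h1)

end OnePointZeroFive

end Literature.NumberTheory.EllipticCurves

end
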